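import Literature.Analysis.FluidPDE.CollisionalTransfer
import Literature.Analysis.FluidPDE.CollisionalTransferMeasurable
import Literature.Analysis.FunctionSpaces.TorusConvolution
import Literature.MathematicalPhysics.KineticTheory.HardSphereEulerProofs
import Summits.AtomisticToContinuum.HydrodynamicLimit.Theorems.RelayRaceLocalityRestartPrincipleMeanClosureTools
import Summits.AtomisticToContinuum.HydrodynamicLimit.Theorems.CollisionIsometryCLTMacroClosureStubBalanceB4
import HarnessLib

/-!
# Stub KE-a1 `stub_energyCommutatorBoundary` of crux `MeanFluxClosure`
# (stmt-AtomisticToContinuum-9256, route AnnealedZeroHorizon, line `registered`/birth)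

The streaming energy-current mollification commutator of the crux's reshaped skeleton,
`c∫_{t₁}^{t₂} Σ_a (Dψ(x_a)v_a)|v_a|²/2 ds − ∫_{t₁}^{t₂}∫_x cΣ_a k(x − x_a)(v_a·∇ψ(x))|v_a|²/2 dx ds`
(`c = (N+1)⁻¹`), looks cubic in the velocities. It is not, after a pathwise time integration by
parts: with the mollification defect of the TEST FUNCTION, `χ := ψ − ǩ ⋆ ψ`
(`χ y = ψ y − ∫ k(x − y) ψ(x) dx`, `ǩ y = k(−y)`), the identity `∇(ǩ ⋆ ψ) = ǩ ⋆ ∇ψ`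
(`Torus.partialDeriv_convolution`) makes the commutator equal to `c∫ energyStreaming χ (Φ_s z) ds`,
and the weak energy balance law for the `C¹` test function `χ`
(`HardSphereFlow.energyObservable_sub_eq_torus`) turns that into
`c[E_χ(Φ_{t₂} z) − E_χ(Φ_{t₁} z)] − c W^e_χ(z)` on the good set (`E_χ(w) = Σ_a χ(x_a)|v_a|²/2`,
`W^e_χ` the collisional energy transfer). This file proves the registered stub KE-a1: the functional
"commutator + c W^e_χ" — almost surely `c[E_χ(Φ_{t₂} z) − E_χ(Φ_{t₁} z)]` — is integrable under
the local Gibbs law with `|expectation| ≤ ε` for kernels supported in a small ball, at every `N`: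
`|E_χ(w)| ≤ ‖χ‖_∞ Σ_a |v_a|²/2`, `‖χ‖_∞ ≤ ℓ sup‖∇ψ‖` (one-particle mollifier commutator of
`…Theorems.CollisionIsometryCLTMacroClosureStubBalanceB4`), energy conservation along the flow and
the Gaussian second moment `E cΣ|v_a|² ≤ 3 sup θ₀ + sup‖u₀‖²`
(`…Theorems.RelayRaceLocalityRestartPrincipleMeanClosureTools`). No cubic moment appears.

References: Spohn 1991 Part I §3.2 (microscopic currents); Evans, PDE, App. C.4 (mollifiers).
-/

noncomputable section

namespace Summit.AtomisticToContinuum.HydrodynamicLimit.Theorems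

open scoped BigOperators ENNReal Topology ContDiff Convolution InnerProductSpace
open MeasureTheory Set Filter
open Literature.MathematicalPhysics.KineticTheory Literature.Analysis.FluidPDE Literature.Analysis.FunctionSpaces
open Summit.AtomisticToContinuum.HydrodynamicLimit.Theorems.MacroClosureLine.Barycentric
open Summit.AtomisticToContinuum.HydrodynamicLimit.Theorems.RestartPrinciple.AgeDuhamelForgetting
open Summit.AtomisticToContinuum.HydrodynamicLimit.Theorems.NearConstantShortTimeHL

namespace EnergyCommutatorBoundary

/-! ## The reflected kernel and the mollified test function -/

variable {k : T3 → ℝ} {ℓ : ℝ}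

/-- The reflected kernel `ǩ y = k (−y)`. -/
theorem continuous_reflect (hk : Continuous k) : Continuous fun y : T3 => k (-y) :=
  hk.comp continuous_neg

/-- The reflected kernel is integrable (continuous on the compact torus). -/
theorem integrable_reflect (hk : Continuous k) : Integrable (fun y : T3 => k (-y)) :=
  integrable_of_continuous_T3 (continuous_reflect hk)

/-- The reflected kernel has the same (unit) mass: Haar measure on `T³` is negation invariant. -/
theorem integral_reflect (k : T3 → ℝ) : ∫ y : T3, k (-y) = ∫ y, k y := by
  haveI := MesoLLN.isNegInvariant_volume_T3
  exact integral_neg_eq_self k volume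

/-- The reflected kernel is supported in the same ball. -/
theorem reflect_eq_zero_of_le (hsupp : ∀ y, k y ≠ 0 → Torus.euclidDist y 0 < ℓ) (y : T3)
    (hy : ℓ ≤ Torus.euclidDist y 0) : k (-y) = 0 := by
  by_contra h
  have h1 := hsupp (-y) h
  rw [show (-y : T3) = 0 - y from (zero_sub y).symm, MesoLLN.euclidDist_sub_zero,
    Torus.euclidDist_comm] at h1
  rw [show Torus.euclidDist y 0 = Torus.euclidDist (y - 0) 0 by rw [sub_zero],
    MesoLLN.euclidDist_sub_zero] at hy
  exact absurd h1 (not_lt.2 hy)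

/-- The mollification `ǩ ⋆ g` (Mathlib convolution on the abelian torus) written with the kernel
centred at the particle: `(ǩ ⋆ g)(y) = ∫ k(x − y) g(x) dx`. -/
theorem reflect_convolution_apply (k : T3 → ℝ) (g : T3 → ℝ) (y : T3) :
    ((fun t : T3 => k (-t)) ⋆ g) y = ∫ x, k (x - y) * g x := by
  rw [convolution_lsmul]
  simp only [smul_eq_mul]
  haveI := MesoLLN.isNegInvariant_volume_T3
  have h1 : ∫ t : T3, k (-t) * g (y - t) = ∫ t : T3, k t * g (y + t) := by
    rw [← integral_neg_eq_self (fun t : T3 => k t * g (y + t)) volume]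
    simp [sub_eq_add_neg]
  rw [h1, ← integral_add_right_eq_self (fun x : T3 => k (x - y) * g x) y]
  refine integral_congr_ae (Eventually.of_forall fun t => ?_)
  simp [add_comm]

variable {ψ : T3 → ℝ}

/-- The mollified smooth test function is smooth. -/
theorem isSmooth_moll (hk : Continuous k) (hψ : Torus.IsSmooth ψ) :
    Torus.IsSmooth ((fun t : T3 => k (-t)) ⋆ ψ) :=
  Torus.isSmooth_convolution (integrable_reflect hk) hψ

/-- `∂ᵢ` commutes with the mollification: `∂ᵢ(ǩ ⋆ ψ)(y) = ∫ k(x − y) ∂ᵢψ(x) dx`. -/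
theorem partialDeriv_moll (hk : Continuous k) (hψ : Torus.IsSmooth ψ) (i : Fin 3) (y : T3) :
    Torus.partialDeriv i ((fun t : T3 => k (-t)) ⋆ ψ) y = ∫ x, k (x - y) * Torus.partialDeriv i ψ x := by
  rw [Torus.partialDeriv_convolution (integrable_reflect hk) hψ, reflect_convolution_apply]

/-- The mollification defect of the test function, `χ = ψ − ǩ ⋆ ψ`, as the function of the stub. -/
theorem defect_eq (k : T3 → ℝ) (ψ : T3 → ℝ) :
    (fun y => ψ y - ∫ x, k (x - y) * ψ x) = ψ - ((fun t : T3 => k (-t)) ⋆ ψ) := by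
  funext y
  rw [Pi.sub_apply, reflect_convolution_apply]

/-- The defect `χ` is smooth. -/
theorem isSmooth_defect (hk : Continuous k) (hψ : Torus.IsSmooth ψ) :
    Torus.IsSmooth (fun y => ψ y - ∫ x, k (x - y) * ψ x) := by
  rw [defect_eq]
  exact hψ.sub (isSmooth_moll hk hψ)

/-- **Sup bound on the defect**: `|χ(y)| ≤ ℓ · L` when `‖∇ψ‖ ≤ L` and `k ≥ 0` has unit mass and
support in the `ℓ`-ball (one-particle mollifier commutator). -/
theorem abs_defect_le (hk : Continuous k) (hk0 : ∀ y, 0 ≤ k y) (hk1 : ∫ y, k y = 1)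
    (hsupp : ∀ y, k y ≠ 0 → Torus.euclidDist y 0 < ℓ) (hψ : Torus.IsSmooth ψ) {L : ℝ}
    (hL : ∀ x, ‖Torus.gradient ψ x‖ ≤ L) (y : T3) :
    |ψ y - ∫ x, k (x - y) * ψ x| ≤ ℓ * L := by
  have h := B4.abs_sub_integral_mul_translate_le (φ := fun t : T3 => k (-t)) (r := ℓ) (L := L)
    (fun t => hk0 _) (integrable_reflect hk) (by rw [integral_reflect, hk1])
    (reflect_eq_zero_of_le hsupp) hψ hL y
  have hre : ∫ x, ψ x * (fun t : T3 => k (-t)) (y - x) = ∫ x, k (x - y) * ψ x :=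
    integral_congr_ae (Eventually.of_forall fun x => by simp [neg_sub, mul_comm])
  rwa [hre] at h

/-! ## Linearity of the streaming term in the test function -/

variable {n : ℕ}

/-- `D(f − g) = Df − Dg` for `C¹` functions on the torus. -/
theorem torusFderiv_sub {f g : T3 → ℝ} (hf : Torus.IsContDiff 1 f) (hg : Torus.IsContDiff 1 g)
    (x : T3) : Torus.fderiv (f - g) x = Torus.fderiv f x - Torus.fderiv g x := by
  unfold Torus.fderiv
  rw [show Torus.liftAt (f - g) x = Torus.liftAt f x - Torus.liftAt g x from rfl]
  exact _root_.fderiv_sub ((hf.liftAt x).differentiable one_ne_zero).differentiableAt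
    ((hg.liftAt x).differentiable one_ne_zero).differentiableAt

/-- The streaming energy flux is linear in the test function: `eS(f − g) = eS f − eS g`. -/
theorem energyStreaming_sub {f g : T3 → ℝ} (hf : Torus.IsContDiff 1 f) (hg : Torus.IsContDiff 1 g)
    (w : Config n (Fin 3) T3) :
    energyStreaming (f - g) w = energyStreaming f w - energyStreaming g w := by
  simp only [energyStreaming, torusFderiv_sub hf hg, sub_apply, sub_mul,
    Finset.sum_sub_distrib]

/-! ## The mollified streaming term is the streaming term of the mollified test function -/

/-- **Key pointwise identity**: the `x`-integral of the k-mollified kinetic energy current tested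
with `∇ψ` is `c · energyStreaming (ǩ ⋆ ψ)` of the configuration. -/
theorem integral_mollified_current_eq (hk : Continuous k) (hψ : Torus.IsSmooth ψ) (c : ℝ)
    (w : Config n (Fin 3) T3) :
    ∫ x, c * ∑ a, k (x - (w a).1) * ((∑ i, (w a).2 i * Torus.partialDeriv i ψ x) * (‖(w a).2‖ ^ 2 / 2)) =
      c * energyStreaming ((fun t : T3 => k (-t)) ⋆ ψ) w := by
  have hψ1 : Torus.IsContDiff 1 ψ := hψ.isContDiff (by simp)
  have hm1 : Torus.IsContDiff 1 ((fun t : T3 => k (-t)) ⋆ ψ) := (isSmooth_moll hk hψ).isContDiff (by simp)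
  -- integrability of the summands in `x`
  have hcont : ∀ i : Fin 3, Continuous fun x => Torus.partialDeriv i ψ x :=
    fun i => (hψ.partialDeriv i).continuous
  have hint : ∀ (a : Fin n) (i : Fin 3),
      Integrable fun x : T3 => k (x - (w a).1) * Torus.partialDeriv i ψ x := fun a i =>
    integrable_of_continuous_T3 ((hk.comp (continuous_id.sub continuous_const)).mul (hcont i))
  -- expand the right-hand side
  have hR : energyStreaming ((fun t : T3 => k (-t)) ⋆ ψ) w =
      ∑ a, (∑ i, (w a).2 i * ∫ x, k (x - (w a).1) * Torus.partialDeriv i ψ x) * (‖(w a).2‖ ^ 2 / 2) := by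
    unfold energyStreaming
    refine Finset.sum_congr rfl fun a _ => ?_
    rw [Torus.fderiv_apply_eq_sum_partialDeriv hm1]
    simp only [smul_eq_mul, partialDeriv_moll hk hψ]
  -- expand the left-hand side
  have hL : ∀ x : T3, c * ∑ a, k (x - (w a).1) * ((∑ i, (w a).2 i * Torus.partialDeriv i ψ x) * (‖(w a).2‖ ^ 2 / 2)) =
      ∑ a, ∑ i, (c * ((w a).2 i * (‖(w a).2‖ ^ 2 / 2))) * (k (x - (w a).1) * Torus.partialDeriv i ψ x) := by
    intro x
    rw [Finset.mul_sum]
    refine Finset.sum_congr rfl fun a _ => ?_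
    rw [Finset.sum_mul, Finset.mul_sum, Finset.mul_sum]
    exact Finset.sum_congr rfl fun i _ => by ring
  simp_rw [hL]
  rw [integral_finsetSum _ fun a _ => integrable_finsetSum _ fun i _ => (hint a i).const_mul _]
  rw [hR, Finset.mul_sum]
  refine Finset.sum_congr rfl fun a _ => ?_
  rw [integral_finsetSum _ fun i _ => (hint a i).const_mul _, Finset.sum_mul, Finset.mul_sum]
  refine Finset.sum_congr rfl fun i _ => ?_
  rw [integral_const_mul]
  ring


/-! ## Along a good orbit: interval integrability and the balance law for the defect -/

/-- The streaming energy flux of a `C¹` test function is interval integrable along a good orbit on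
any window `[t₁, t₂]`, `t₁ ≤ t₂` (from the weak balance law at the time-`t₁` point, shifted). -/
theorem intervalIntegrable_energyStreaming {ε : ℝ} (Φ : HardSphereFlow (Torus.geometry (Fin 3)) ε n)
    {f : T3 → ℝ} (hf : Torus.IsContDiff 1 f) {z : Config n (Fin 3) T3} (hz : z ∈ Φ.good)
    {t₁ t₂ : ℝ} (h : t₁ ≤ t₂) :
    IntervalIntegrable (fun s => energyStreaming f (Φ.flow s z)) volume t₁ t₂ := by
  have H := (Φ.energyObservable_sub_eq_torus hf (Φ.mapsTo_good t₁ hz) (sub_nonneg.2 h)).1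
  have hshift : ∀ s, Φ.flow s (Φ.flow t₁ z) = Φ.flow (s + t₁) z := fun s => (Φ.flow_add s t₁ z hz).symm
  simp only [hshift] at H
  have H2 := H.comp_add_right (-t₁)
  simp only [neg_add_cancel_right, zero_add, sub_neg_eq_add, sub_add_cancel] at H2
  exact H2

/-- Pathwise energy balance over `[t₁, t₂]` on the good set for a `C¹` test function
(`HardSphereFlow.energyObservable_sub_eq_torus` transported by the group law). -/
theorem energyObservable_flow_sub_flow {ε : ℝ} (Φ : HardSphereFlow (Torus.geometry (Fin 3)) ε n)
    {f : T3 → ℝ} (hf : Torus.IsContDiff 1 f) {z : Config n (Fin 3) T3} (hz : z ∈ Φ.good)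
    {t₁ t₂ : ℝ} (h : t₁ ≤ t₂) :
    energyObservable f (Φ.flow t₂ z) - energyObservable f (Φ.flow t₁ z) =
      (∫ s in t₁..t₂, energyStreaming f (Φ.flow s z)) + Φ.energyTransfer f (Φ.flow t₁ z) (t₂ - t₁) := by
  have hz₁ : Φ.flow t₁ z ∈ Φ.good := Φ.mapsTo_good t₁ hz
  obtain ⟨-, H⟩ := Φ.energyObservable_sub_eq_torus hf hz₁ (sub_nonneg.2 h)
  have hshift : ∀ s, Φ.flow s (Φ.flow t₁ z) = Φ.flow (s + t₁) z := fun s => (Φ.flow_add s t₁ z hz).symm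
  simp only [hshift, sub_add_cancel] at H
  rw [H, intervalIntegral.integral_comp_add_right (fun s => energyStreaming f (Φ.flow s z)) t₁]
  simp

/-- **The functional of the stub on the good set** (pathwise time integration by parts): commutator
`+ c W^e_χ` equals `c [E_χ(Φ_{t₂} z) − E_χ(Φ_{t₁} z)]`, `χ = ψ − ǩ ⋆ ψ`. -/
theorem functional_eq_on_good (hk : Continuous k) (hψ : Torus.IsSmooth ψ) {ε : ℝ}
    (Φ : HardSphereFlow (Torus.geometry (Fin 3)) ε n) {z : Config n (Fin 3) T3} (hz : z ∈ Φ.good)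
    {t₁ t₂ : ℝ} (h : t₁ ≤ t₂) (c : ℝ) :
    c * (∫ s in t₁..t₂, energyStreaming ψ (Φ.flow s z)) -
        (∫ s in t₁..t₂, ∫ x, c * ∑ a, k (x - (Φ.flow s z a).1) *
          ((∑ i, (Φ.flow s z a).2 i * Torus.partialDeriv i ψ x) * (‖(Φ.flow s z a).2‖ ^ 2 / 2))) +
        c * Φ.energyTransfer (fun y => ψ y - ∫ x, k (x - y) * ψ x) (Φ.flow t₁ z) (t₂ - t₁) =
      c * (energyObservable (fun y => ψ y - ∫ x, k (x - y) * ψ x) (Φ.flow t₂ z) -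
        energyObservable (fun y => ψ y - ∫ x, k (x - y) * ψ x) (Φ.flow t₁ z)) := by
  have hψ1 : Torus.IsContDiff 1 ψ := hψ.isContDiff (by simp)
  have hm1 : Torus.IsContDiff 1 ((fun t : T3 => k (-t)) ⋆ ψ) := (isSmooth_moll hk hψ).isContDiff (by simp)
  have hχ1 : Torus.IsContDiff 1 (fun y => ψ y - ∫ x, k (x - y) * ψ x) :=
    (isSmooth_defect hk hψ).isContDiff (by simp)
  simp_rw [integral_mollified_current_eq hk hψ c]
  rw [intervalIntegral.integral_const_mul, ← mul_sub,
    ← intervalIntegral.integral_sub (intervalIntegrable_energyStreaming Φ hψ1 hz h)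
      (intervalIntegrable_energyStreaming Φ hm1 hz h)]
  have hstream : ∀ s, energyStreaming ψ (Φ.flow s z) - energyStreaming ((fun t : T3 => k (-t)) ⋆ ψ) (Φ.flow s z) =
      energyStreaming (fun y => ψ y - ∫ x, k (x - y) * ψ x) (Φ.flow s z) := by
    intro s
    rw [defect_eq, energyStreaming_sub hψ1 hm1]
  simp_rw [hstream]
  rw [energyObservable_flow_sub_flow Φ hχ1 hz h]
  ring

/-- The energy observable of a bounded test function is bounded by the kinetic energy:
`|E_χ(w)| ≤ M Σ_a |v_a|²/2` when `|χ| ≤ M`. -/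
theorem abs_energyObservable_le {χ : T3 → ℝ} {M : ℝ} (hM : ∀ y, |χ y| ≤ M)
    (w : Config n (Fin 3) T3) : |energyObservable χ w| ≤ M * ∑ a, ‖(w a).2‖ ^ 2 / 2 := by
  unfold energyObservable
  rw [Finset.mul_sum]
  refine (Finset.abs_sum_le_sum_abs _ _).trans (Finset.sum_le_sum fun a _ => ?_)
  rw [abs_mul, abs_of_nonneg (by positivity : (0 : ℝ) ≤ ‖(w a).2‖ ^ 2 / 2)]
  exact mul_le_mul_of_nonneg_right (hM _) (by positivity)

/-- The mean of a nonnegative integrable function is controlled by a `lintegral` bound. -/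
theorem integral_le_of_lintegral_le {α : Type*} [MeasurableSpace α] {μ : Measure α} {f : α → ℝ}
    (hf0 : 0 ≤ᵐ[μ] f) (hfm : AEStronglyMeasurable f μ) {B : ℝ} (hB : 0 ≤ B)
    (h : ∫⁻ z, ENNReal.ofReal (f z) ∂μ ≤ ENNReal.ofReal B) : ∫ z, f z ∂μ ≤ B := by
  rw [integral_eq_lintegral_of_nonneg_ae hf0 hfm]
  exact ENNReal.toReal_le_of_le_ofReal hB h

end EnergyCommutatorBoundary

open EnergyCommutatorBoundary in
/-- **Stub KE-a1 `stub_energyCommutatorBoundary`** (crux `MeanFluxClosure`, stmt-AtomisticToContinuum-9256,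
line `registered`): the streaming energy-current mollification commutator plus `c` times the
collisional energy transfer of the test-function defect `χ = ψ − ǩ⋆ψ` is, almost surely under the
local Gibbs law, `c[E_χ(Φ_{t₂}z) − E_χ(Φ_{t₁}z)]` (pathwise time integration by parts), hence
integrable with `|expectation| ≤ ℓ · sup‖∇ψ‖ · (3 sup θ₀ + sup‖u₀‖²) ≤ ε` for kernels supported in
the `ℓ`-ball, `ℓ = ε / (sup‖∇ψ‖ (3 sup θ₀ + sup‖u₀‖²) + 1)`, at every `N` (σ₀ = 1/2). -/
theorem stub_energyCommutatorBoundary : ∀ (a₀ θ₀ : Literature.MathematicalPhysics.KineticTheory.T3 → ℝ) (u₀ : Literature.MathematicalPhysics.KineticTheory.T3 → Literature.MathematicalPhysics.KineticTheory.V3), Continuous a₀ → Continuous θ₀ → Continuous u₀ → (∀ x, 0 < a₀ x) → (∀ x, 0 < θ₀ x) → ∃ σ₀ : ℝ, 0 < σ₀ ∧ ∀ σ : ℝ, 0 < σ → σ < σ₀ → ∀ Φ : (N : ℕ) → Literature.Analysis.FluidPDE.HardSphereFlow (Literature.Analysis.FluidPDE.Torus.geometry (Fin 3)) (Literature.MathematicalPhysics.KineticTheory.hsDiameter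 σ N) (N + 1), ∀ t₁ t₂ : ℝ, 0 ≤ t₁ → t₁ ≤ t₂ → ∀ ε : ℝ, 0 < ε → (∀ ψ : Literature.MathematicalPhysics.KineticTheory.T3 → ℝ, Literature.Analysis.FunctionSpaces.Torus.IsSmooth ψ → ∃ ℓ : ℝ, 0 < ℓ ∧ ∀ k : Literature.MathematicalPhysics.KineticTheory.T3 → ℝ, (Continuous k ∧ (∀ y, 0 ≤ k y) ∧ (∫ y, k y = 1) ∧ (∀ y, k y ≠ 0 → Literature.Analysis.FluidPDE.Torus.euclidDist y 0 < ℓ)) → ∀ᶠ N in Filter.atTop, ∀ D : Literature.Analysis.FluidPDE.Config (N + 1) (Fin 3) Literature.MathematicalPhysics.KineticTheory.T3 → ℝ, D = (fun z => ((N + 1 : ℕ) : ℝ)⁻¹ * (∫ s in t₁..t₂, Literature.Analysis.FluidPDE.energyStreaming ψ ((Φ N).flow s z)) - (∫ s in t₁..t₂, ∫ x, ((N + 1 : ℕ) : ℝ)⁻¹ * ∑ a, k (x - ((Φ N).flow s z a).1) * ((∑ i, ((Φ N).flow s z a).2 i * Literature.Analysis.FunctionSpaces.Torus.partialDeriv i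 ψ x) * (‖((Φ N).flow s z a).2‖ ^ 2 / 2))) + ((N + 1 : ℕ) : ℝ)⁻¹ * (Φ N).energyTransfer (fun y => ψ y - ∫ x, k (x - y) * ψ x) ((Φ N).flow t₁ z) (t₂ - t₁)) → MeasureTheory.Integrable D (Literature.MathematicalPhysics.KineticTheory.localGibbsLaw σ a₀ u₀ θ₀ N (Φ N)) ∧ |∫ z, D z ∂Literature.MathematicalPhysics.KineticTheory.localGibbsLaw σ a₀ u₀ θ₀ N (Φ N)| ≤ ε) := by
  intro a₀ θ₀ u₀ ha hθ hu hap hθp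
  refine ⟨1 / 2, by norm_num, ?_⟩
  intro σ _hσ hσ2 Φ t₁ t₂ _h₁ h₁₂ ε hε ψ hψ
  have hψ1 : Torus.IsContDiff 1 ψ := hψ.isContDiff (by simp)
  -- a bound `L` on `‖∇ψ‖`
  obtain ⟨L, hL⟩ : ∃ L, ∀ x, ‖Torus.gradient ψ x‖ ≤ L := by
    obtain ⟨C, hC⟩ := Torus.exists_forall_norm_le_of_continuous (Torus.continuous_fderiv hψ1)
    exact ⟨C, fun x => by rw [B4.norm_gradient_eq_norm_fderiv]; exact hC x⟩
  have hL0 : 0 ≤ L := (norm_nonneg _).trans (hL 0)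
  -- a bound `B₁` on `3θ₀ + ‖u₀‖²`
  obtain ⟨Θ, -, hΘ⟩ := exists_forall_abs_le_of_continuous hθ
  obtain ⟨U, -, hU⟩ := exists_forall_abs_le_of_continuous (continuous_norm.comp hu)
  have hB₁ : ∀ x, 3 * θ₀ x + ‖u₀ x‖ ^ 2 ≤ 3 * Θ + U ^ 2 := fun x => by
    have h1 : θ₀ x ≤ Θ := (le_abs_self _).trans (hΘ x)
    have h2 : ‖u₀ x‖ ^ 2 ≤ U ^ 2 := pow_le_pow_left₀ (norm_nonneg _) ((le_abs_self _).trans (hU x)) 2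
    linarith
  have hB₁0 : 0 ≤ 3 * Θ + U ^ 2 :=
    le_trans (add_nonneg (mul_nonneg zero_le_three (hθp 0).le) (sq_nonneg _)) (hB₁ 0)
  set B₁ : ℝ := 3 * Θ + U ^ 2 with hB₁def
  refine ⟨ε / (L * B₁ + 1), div_pos hε (by positivity), ?_⟩
  intro k hk
  obtain ⟨hkc, hk0, hk1, hksupp⟩ := hk
  refine Eventually.of_forall fun N => ?_
  intro D hD
  set ℓ : ℝ := ε / (L * B₁ + 1) with hℓdef
  have hℓ0 : 0 ≤ ℓ := (div_pos hε (by positivity)).le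
  set c : ℝ := ((N + 1 : ℕ) : ℝ)⁻¹ with hcdef
  have hc0 : 0 ≤ c := inv_nonneg.2 (Nat.cast_nonneg _)
  set χ : T3 → ℝ := fun y => ψ y - ∫ x, k (x - y) * ψ x with hχdef
  have hχs : Torus.IsSmooth χ := isSmooth_defect hkc hψ
  have hχc : Continuous χ := hχs.continuous
  have hMχ : ∀ y, |χ y| ≤ ℓ * L := abs_defect_le hkc hk0 hk1 hksupp hψ hL
  -- the law
  set μ := localGibbsLaw σ a₀ u₀ θ₀ N (Φ N) with hμdef
  have hap' : ∀ x, 0 ≤ a₀ x := fun x => (hap x).le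
  have hP : IsProbabilityMeasure μ := isProbabilityMeasure_localGibbsLaw ha hθ hu hap hθp hσ2.le N (Φ N)
  have hPac : μ ≪ liouville (Torus.geometry (Fin 3)) (N + 1) (hsDiameter σ N) :=
    particleLaw_absolutelyContinuous (Φ N) _
  -- the a.s. representative
  set G : Config (N + 1) (Fin 3) T3 → ℝ := fun z =>
    c * (energyObservable χ ((Φ N).flow t₂ z) - energyObservable χ ((Φ N).flow t₁ z)) with hGdef
  have hDG : D =ᵐ[μ] G := by
    filter_upwards [hPac.ae_le (Φ N).ae_mem_good] with z hz
    rw [hD]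
    exact functional_eq_on_good hkc hψ (Φ N) hz h₁₂ c
  have hGm : Measurable G := by
    have hE : Measurable (energyObservable (d := Fin 3) (N := N + 1) χ) :=
      (continuous_energyObservable hχc).measurable
    exact measurable_const.mul ((hE.comp ((Φ N).measurable_flow t₂)).sub (hE.comp ((Φ N).measurable_flow t₁)))
  -- the dominating function
  set H : Config (N + 1) (Fin 3) T3 → ℝ := fun z =>
    ℓ * L / 2 * ((c * ∑ i, ‖((Φ N).flow t₂ z i).2‖ ^ 2) + (c * ∑ i, ‖((Φ N).flow t₁ z i).2‖ ^ 2)) with hHdef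
  have hK : ∀ s, Integrable (fun z => c * ∑ i, ‖((Φ N).flow s z i).2‖ ^ 2) μ := fun s =>
    integrable_avg_norm_sq_vel_flow (Φ N) ha hθ hu hap' hθp hP s
  have hHi : Integrable H μ := ((hK t₂).add (hK t₁)).const_mul _
  have hGH : ∀ z, |G z| ≤ H z := by
    intro z
    have h2 := abs_energyObservable_le hMχ ((Φ N).flow t₂ z)
    have h1 := abs_energyObservable_le hMχ ((Φ N).flow t₁ z)
    simp only [hGdef, hHdef]
    rw [abs_mul, abs_of_nonneg hc0]
    have hsum : ∀ w : Config (N + 1) (Fin 3) T3, ∑ a, ‖(w a).2‖ ^ 2 / 2 = (∑ a, ‖(w a).2‖ ^ 2) / 2 :=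
      fun w => by rw [Finset.sum_div]
    rw [hsum] at h1 h2
    calc c * |energyObservable χ ((Φ N).flow t₂ z) - energyObservable χ ((Φ N).flow t₁ z)|
        ≤ c * (ℓ * L * ((∑ a, ‖((Φ N).flow t₂ z a).2‖ ^ 2) / 2) +
            ℓ * L * ((∑ a, ‖((Φ N).flow t₁ z a).2‖ ^ 2) / 2)) :=
          mul_le_mul_of_nonneg_left ((abs_sub _ _).trans (add_le_add h2 h1)) hc0
      _ = ℓ * L / 2 * ((c * ∑ i, ‖((Φ N).flow t₂ z i).2‖ ^ 2) + (c * ∑ i, ‖((Φ N).flow t₁ z i).2‖ ^ 2)) := by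
          ring
  have hGi : Integrable G μ :=
    hHi.mono' hGm.aestronglyMeasurable (Eventually.of_forall fun z => by
      rw [Real.norm_eq_abs]; exact hGH z)
  refine ⟨hGi.congr hDG.symm, ?_⟩
  -- the mean bound
  have hmean : ∀ s, ∫ z, c * ∑ i, ‖((Φ N).flow s z i).2‖ ^ 2 ∂μ ≤ B₁ := by
    intro s
    have hae : (fun z => c * ∑ i, ‖((Φ N).flow s z i).2‖ ^ 2) =ᵐ[μ] fun z => c * ∑ i, ‖(z i).2‖ ^ 2 := by
      filter_upwards [sum_norm_sq_vel_flow_ae (Φ N) hPac s] with z hz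
      rw [hz]
    rw [integral_congr_ae hae]
    haveI : IsProbabilityMeasure (particleLaw (Φ N) (canonicalDensity (Torus.geometry (Fin 3))
        (hsDiameter σ N) (N + 1) (localGibbsProfile a₀ u₀ θ₀))) := hP
    refine integral_le_of_lintegral_le (Eventually.of_forall fun z =>
      mul_nonneg hc0 (Finset.sum_nonneg fun i _ => sq_nonneg _)) ?_ hB₁0
      (lintegral_avg_norm_sq_vel_le (Φ N) ha hθ hu hap' hθp hB₁)
    exact (measurable_const.mul (Finset.measurable_sum _ fun i _ =>
      ((measurable_pi_apply i).snd).norm.pow_const 2)).aestronglyMeasurable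
  rw [integral_congr_ae hDG]
  calc |∫ z, G z ∂μ| ≤ ∫ z, |G z| ∂μ := abs_integral_le_integral_abs
    _ ≤ ∫ z, H z ∂μ := integral_mono hGi.abs hHi hGH
    _ = ℓ * L / 2 * ((∫ z, c * ∑ i, ‖((Φ N).flow t₂ z i).2‖ ^ 2 ∂μ) +
          ∫ z, c * ∑ i, ‖((Φ N).flow t₁ z i).2‖ ^ 2 ∂μ) := by
        rw [hHdef, integral_const_mul, integral_add (hK t₂) (hK t₁)]
    _ ≤ ℓ * L / 2 * (B₁ + B₁) := by
        refine mul_le_mul_of_nonneg_left (add_le_add (hmean t₂) (hmean t₁)) (by positivity)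
    _ = ℓ * (L * B₁) := by ring
    _ ≤ ε := by
        rw [hℓdef, div_mul_eq_mul_div, div_le_iff₀ (by positivity)]
        nlinarith [mul_nonneg hL0 hB₁0]

end Summit.AtomisticToContinuum.HydrodynamicLimit.Theorems

end
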